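import Literature.Probability.LatticeModels.AnisotropicInfraredConstantBound
import Mathlib.MeasureTheory.Integral.Gamma
import Mathlib.MeasureTheory.Measure.Lebesgue.Integral
import Mathlib.Analysis.Complex.ExponentialBounds
import HarnessLib

/-!
# Laplace-method bounds with the sharp leading constant for `B(s) = ∫_{-π}^{π} e^{−s(1−cos k)}dk = 2πe^{−s}I₀(s)`

Topic `Probability/LatticeModels`; the one-dimensional factor of the heat-kernel representation of the
lattice Green functions (`AnisotropicInfraredConstantBound.lean`: `besselFactor`,
`klsConstant_eq_integral`: `C(r) = (2π)⁻³∫₀^∞ B(t)²B(rt)dt`). The parent file bounds `B` through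
Jordan's inequality (`B(s)² ≤ π³/(2s)`), which loses the factor `π²/4` against the true asymptotics
`B(s)² ∼ 2π/s`; here the LEADING CONSTANT IS SHARP:

* `AnisotropicRotator.besselFactor_le_laplace` — **`B(s) ≤ √(2π/s) + A·s^{-3/2} + πe^{-s}`** for `s > 0`,
  `A = (√π/32)(1/2 − π²/96)^{-5/2} ≤ 3/5` (`laplaceConst_le`): on `|k| ≤ π/2`,
  `e^{−s(1−cos k)} ≤ e^{−sk²/2}e^{sk⁴/24} ≤ e^{−sk²/2}(1 + (sk⁴/24)e^{sπ²k²/96})` (`1 − cos k ≥ k²/2 − k⁴/24`,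
  `e^y ≤ 1 + ye^y`), the Gaussian integral and the fourth Gaussian moment (`Γ(5/2) = 3√π/4`); on
  `π/2 ≤ |k| ≤ π`, `cos k ≤ 0`;
* `AnisotropicRotator.besselFactor_le_two_term` — `B(t) ≤ √(2π/t) + (21/10)t^{-3/2}` for `t ≥ 1`
  (`t^{3/2}e^{-t} ≤ 9/20`), and its square `besselFactor_sq_le`:
  `B(t)² ≤ 2πt⁻¹ + (21/5)√(2π)t⁻² + (441/100)t⁻³`;
* `AnisotropicRotator.besselFactor_le_quadratic` / `twoPi_mul_one_sub_le_besselFactor` —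
  `2π(1 − u) ≤ B(u) ≤ 2π(1 − u + (3/4)u²)` (`u ≥ 0` for the upper bound), from `1 − x ≤ e^{−x} ≤ 1 − x + x²/2`
  and `∫(1 − cos k) = 2π`, `∫(1 − cos k)² = 3π`;
* `AnisotropicRotator.besselFactor_ge_gaussian` — **`B(s) ≥ √(2π/s) − (4/(πs))e^{−π²s/2}`** (`1 − cos k ≤ k²/2`
  and the Gaussian tails beyond `|k| = π`).

These feed `AnisotropicInfraredConstantLog.lean` (`C(r) ≤ 1 + (2π)⁻¹ln(1/r)`, `C(r) ≥ 1/6 + (2π)⁻¹ln(1/r)`).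
All statements are elementary real analysis; nothing here concerns a model.

## References

* J. Fröhlich, R. Israel, E. H. Lieb, B. Simon, Comm. Math. Phys. 62 (1978) 1–34, (4.7) (the
  one-dimensional factor of `∫dp/E_p` in the heat-kernel representation) [FILS1978].
-/

noncomputable section

open MeasureTheory Set Filter
open scoped BigOperators Real Topology

namespace Literature.Probability.LatticeModels

namespace AnisotropicRotator

/-! ### Elementary inequalities -/

/-- `k²/2 − k⁴/24 ≤ 1 − cos k` for every real `k` (the quartic Taylor bound `cos k ≤ 1 − k²/2 + k⁴/24`,
from `sin x ≥ x − x³/6` at `x = |k|/2` and `1 − cos k = 2 sin²(k/2)`). [folklore] -/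
private theorem sq_half_sub_le_one_sub_cos (k : ℝ) : k ^ 2 / 2 - k ^ 4 / 24 ≤ 1 - Real.cos k := by
  rcases le_or_gt (k ^ 2) 12 with hk | hk
  · -- `1 - cos k = 2 sin²(|k|/2)` and `sin(|k|/2) ≥ |k|/2 - |k|³/48 ≥ 0`
    have ha : 0 ≤ |k| := abs_nonneg k
    have hid : 1 - Real.cos k = 2 * Real.sin (|k| / 2) ^ 2 := by
      rw [Real.sin_sq_eq_half_sub, show 2 * (|k| / 2) = |k| by ring, Real.cos_abs]
      ring
    have hsin : |k| / 2 - (|k| / 2) ^ 3 / 6 ≤ Real.sin (|k| / 2) := Real.sin_ge_sub_cube (by positivity)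
    have hk2 : |k| ^ 2 = k ^ 2 := sq_abs k
    have hnn : 0 ≤ |k| / 2 - (|k| / 2) ^ 3 / 6 := by
      have h1 : |k| / 2 - (|k| / 2) ^ 3 / 6 = |k| / 2 * (1 - |k| ^ 2 / 24) := by ring
      rw [h1]
      exact mul_nonneg (by positivity) (by rw [hk2]; linarith)
    have hsq : (|k| / 2 - (|k| / 2) ^ 3 / 6) ^ 2 ≤ Real.sin (|k| / 2) ^ 2 :=
      pow_le_pow_left₀ hnn hsin 2
    have hk4 : |k| ^ 4 = k ^ 4 := by rw [show (4 : ℕ) = 2 * 2 by norm_num, pow_mul, hk2, ← pow_mul]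
    have hk6 : 0 ≤ |k| ^ 6 := by positivity
    have hexp : 2 * (|k| / 2 - (|k| / 2) ^ 3 / 6) ^ 2 = |k| ^ 2 / 2 - |k| ^ 4 / 24 + |k| ^ 6 / 1152 := by
      ring
    rw [hid]
    nlinarith [hsq, hexp, hk2, hk4, hk6]
  · have hcos : Real.cos k ≤ 1 := Real.cos_le_one k
    have hneg : k ^ 2 / 2 - k ^ 4 / 24 ≤ 0 := by
      have h4 : k ^ 4 = k ^ 2 * k ^ 2 := by ring
      nlinarith [sq_nonneg k]
    linarith

/-- `e^y ≤ 1 + y e^y` for every real `y` (from `1 − y ≤ e^{−y}`). [folklore] -/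
private theorem exp_le_one_add_mul_exp (y : ℝ) : Real.exp y ≤ 1 + y * Real.exp y := by
  have h := Real.add_one_le_exp (-y)
  have hmul : (1 - y) * Real.exp y ≤ 1 := by
    calc (1 - y) * Real.exp y ≤ Real.exp (-y) * Real.exp y :=
          mul_le_mul_of_nonneg_right (by linarith) (Real.exp_pos y).le
      _ = 1 := by rw [← Real.exp_add, neg_add_cancel, Real.exp_zero]
  nlinarith [hmul, Real.exp_pos y]

/-- `e^{-x} ≤ 1 − x + x²/2` for `x ≥ 0` (`e^{-x} ≤ 1/(1 + x + x²/2)` and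
`(1 + x + x²/2)(1 − x + x²/2) = 1 + x⁴/4 ≥ 1`). [folklore] -/
private theorem exp_neg_le_quadratic {x : ℝ} (hx : 0 ≤ x) : Real.exp (-x) ≤ 1 - x + x ^ 2 / 2 := by
  have h := Real.quadratic_le_exp_of_nonneg hx
  have hpos : 0 < 1 + x + x ^ 2 / 2 := by positivity
  have h1 : Real.exp (-x) ≤ (1 + x + x ^ 2 / 2)⁻¹ := by
    rw [Real.exp_neg]
    exact inv_anti₀ hpos h
  have h2 : (1 + x + x ^ 2 / 2)⁻¹ ≤ 1 - x + x ^ 2 / 2 := by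
    rw [inv_le_iff_one_le_mul₀ hpos]
    nlinarith [sq_nonneg (x ^ 2)]
  exact h1.trans h2

/-- `1 − x ≤ e^{−x}`. [folklore] -/
private theorem one_sub_le_exp_neg' (x : ℝ) : 1 - x ≤ Real.exp (-x) := by
  have := Real.add_one_le_exp (-x)
  linarith

/-! ### The one-dimensional factor: elementary bounds -/

/-- `B(s) ≥ 0`. (an elementary bound on the cited factor, proved here) [cite: FILS1978, (4.7)] -/
theorem zero_le_besselFactor (s : ℝ) : 0 ≤ besselFactor s :=
  intervalIntegral.integral_nonneg (by linarith [Real.pi_pos]) fun _ _ => (Real.exp_pos _).le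

/-- The integrand of `B(s)` is continuous. [folklore] -/
private theorem continuous_integrand (s : ℝ) :
    Continuous fun k : ℝ => Real.exp (-(s * (1 - Real.cos k))) := by
  fun_prop

/-- `B(s) ≤ 2π` for `s ≥ 0` (the integrand is at most `1`). (an elementary bound on the cited factor, proved here) [cite: FILS1978, (4.7)] -/
theorem besselFactor_le_twoPi {s : ℝ} (hs : 0 ≤ s) : besselFactor s ≤ 2 * π := by
  have hle : (-π : ℝ) ≤ π := by linarith [Real.pi_pos]
  unfold besselFactor
  calc ∫ k in (-π)..π, Real.exp (-(s * (1 - Real.cos k)))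
      ≤ ∫ _ in (-π)..π, (1 : ℝ) := by
        refine intervalIntegral.integral_mono_on hle ((continuous_integrand s).intervalIntegrable _ _)
          (by simp) fun k _ => ?_
        rw [Real.exp_le_one_iff]
        have := Real.cos_le_one k
        nlinarith
    _ = 2 * π := by simp; ring

/-- **`B(u) ≥ 2π(1 − u)`** (`e^{−x} ≥ 1 − x` and `∫_{-π}^{π}(1 − cos k)dk = 2π`). (an elementary bound on the cited factor, proved here) [cite: FILS1978, (4.7)] -/
theorem twoPi_mul_one_sub_le_besselFactor (u : ℝ) :
    2 * π * (1 - u) ≤ besselFactor u := by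
  have hle : (-π : ℝ) ≤ π := by linarith [Real.pi_pos]
  have hcos : IntervalIntegrable (fun k : ℝ => Real.cos k) volume (-π) π :=
    Real.continuous_cos.intervalIntegrable _ _
  have hval : ∫ k in (-π)..π, (1 - u * (1 - Real.cos k)) = 2 * π * (1 - u) := by
    have h1 : (fun k : ℝ => 1 - u * (1 - Real.cos k)) = fun k => (1 - u) + u * Real.cos k := by
      funext k; ring
    rw [h1, intervalIntegral.integral_add intervalIntegrable_const (hcos.const_mul _),
      intervalIntegral.integral_const, intervalIntegral.integral_const_mul, integral_cos]
    simp [Real.sin_neg]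
    try ring_nf
    try simp
  unfold besselFactor
  rw [← hval]
  refine intervalIntegral.integral_mono_on hle
    ((by fun_prop : Continuous fun k : ℝ => 1 - u * (1 - Real.cos k)).intervalIntegrable _ _)
    ((continuous_integrand u).intervalIntegrable _ _) fun k _ => ?_
  have := one_sub_le_exp_neg' (u * (1 - Real.cos k))
  linarith

/-- **`B(u) ≤ 2π(1 − u + (3/4)u²)`** for `u ≥ 0` (`e^{−x} ≤ 1 − x + x²/2` and
`∫(1 − cos k) = 2π`, `∫(1 − cos k)² = 3π` over `[-π,π]`). (an elementary bound on the cited factor, proved here) [cite: FILS1978, (4.7)] -/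
theorem besselFactor_le_quadratic {u : ℝ} (hu : 0 ≤ u) :
    besselFactor u ≤ 2 * π * (1 - u + 3 / 4 * u ^ 2) := by
  have hle : (-π : ℝ) ≤ π := by linarith [Real.pi_pos]
  have hcos : IntervalIntegrable (fun k : ℝ => Real.cos k) volume (-π) π :=
    Real.continuous_cos.intervalIntegrable _ _
  have hcos2 : IntervalIntegrable (fun k : ℝ => Real.cos k ^ 2) volume (-π) π :=
    (Real.continuous_cos.pow 2).intervalIntegrable _ _
  have hval : ∫ k in (-π)..π, (1 - u * (1 - Real.cos k) + (u * (1 - Real.cos k)) ^ 2 / 2) =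
      2 * π * (1 - u + 3 / 4 * u ^ 2) := by
    have h1 : (fun k : ℝ => 1 - u * (1 - Real.cos k) + (u * (1 - Real.cos k)) ^ 2 / 2) =
        fun k => ((1 - u + u ^ 2 / 2) + (u - u ^ 2) * Real.cos k) + u ^ 2 / 2 * Real.cos k ^ 2 := by
      funext k; ring
    rw [h1, intervalIntegral.integral_add ((intervalIntegrable_const.add (hcos.const_mul _)))
        (hcos2.const_mul _),
      intervalIntegral.integral_add intervalIntegrable_const (hcos.const_mul _),
      intervalIntegral.integral_const, intervalIntegral.integral_const_mul, integral_cos,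
      intervalIntegral.integral_const_mul, integral_cos_sq]
    simp [Real.sin_neg, Real.cos_neg]
    ring
  unfold besselFactor
  rw [← hval]
  refine intervalIntegral.integral_mono_on hle ((continuous_integrand u).intervalIntegrable _ _)
    (by
      exact (Continuous.intervalIntegrable (by fun_prop) _ _)) fun k _ => ?_
  have hx : 0 ≤ u * (1 - Real.cos k) := mul_nonneg hu (by linarith [Real.cos_le_one k])
  exact exp_neg_le_quadratic hx

/-- `B` is non-increasing: `B(s') ≤ B(s)` for `s ≤ s'`. (an elementary bound on the cited factor, proved here) [cite: FILS1978, (4.7)] -/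
theorem besselFactor_antitone {s s' : ℝ} (h : s ≤ s') : besselFactor s' ≤ besselFactor s := by
  have hle : (-π : ℝ) ≤ π := by linarith [Real.pi_pos]
  unfold besselFactor
  refine intervalIntegral.integral_mono_on hle ((continuous_integrand s').intervalIntegrable _ _)
    ((continuous_integrand s).intervalIntegrable _ _) fun k _ => ?_
  rw [Real.exp_le_exp]
  have := Real.cos_le_one k
  nlinarith

/-! ### The Laplace-method bound with the sharp leading constant -/

/-- `b₀ = 1/2 − π²/96 ≥ 25/64` (the Gaussian rate left after absorbing the quartic correction on
`|k| ≤ π/2`). [folklore] -/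
private theorem laplaceRate_ge : (25 / 64 : ℝ) ≤ 1 / 2 - π ^ 2 / 96 := by
  nlinarith [Real.pi_lt_d2, Real.pi_pos]

/-- `b₀ > 0`. [folklore] -/
private theorem laplaceRate_pos : (0 : ℝ) < 1 / 2 - π ^ 2 / 96 := lt_of_lt_of_le (by norm_num) laplaceRate_ge

/-- `A = (√π/32)·b₀^{-5/2} ≥ 0`. [folklore] -/
private theorem laplaceConst_nonneg : 0 ≤ Real.sqrt π / 32 * (1 / 2 - π ^ 2 / 96) ^ (-(5 / 2 : ℝ)) :=
  mul_nonneg (by positivity) (Real.rpow_nonneg laplaceRate_pos.le _)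

/-- `A = (√π/32)·b₀^{-5/2} ≤ 3/5` (`b₀ ≥ 25/64` gives `b₀^{-5/2} ≤ (8/5)⁵`, and `√π ≤ 1.7725`). [folklore] -/
private theorem laplaceConst_le : Real.sqrt π / 32 * (1 / 2 - π ^ 2 / 96) ^ (-(5 / 2 : ℝ)) ≤ 3 / 5 := by
  have h1 : (1 / 2 - π ^ 2 / 96) ^ (-(5 / 2 : ℝ)) ≤ (25 / 64 : ℝ) ^ (-(5 / 2 : ℝ)) :=
    Real.rpow_le_rpow_of_nonpos (by norm_num) laplaceRate_ge (by norm_num)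
  have h2 : (25 / 64 : ℝ) ^ (-(5 / 2 : ℝ)) = 32768 / 3125 := by
    rw [Real.rpow_neg (by norm_num), show (5 / 2 : ℝ) = 2 + 1 / 2 by norm_num,
      Real.rpow_add (by norm_num), Real.rpow_two, ← Real.sqrt_eq_rpow,
      show (25 / 64 : ℝ) = (5 / 8) ^ 2 by norm_num, Real.sqrt_sq (by norm_num)]
    norm_num
  have h3 : Real.sqrt π ≤ 1.7725 := by
    have h : Real.sqrt π ≤ Real.sqrt (1.7725 ^ 2) :=
      Real.sqrt_le_sqrt (by nlinarith [Real.pi_lt_d4])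
    rwa [Real.sqrt_sq (by norm_num)] at h
  have h4 : 0 ≤ (1 / 2 - π ^ 2 / 96) ^ (-(5 / 2 : ℝ)) := Real.rpow_nonneg laplaceRate_pos.le _
  calc Real.sqrt π / 32 * (1 / 2 - π ^ 2 / 96) ^ (-(5 / 2 : ℝ))
      ≤ 1.7725 / 32 * (32768 / 3125) := by
        rw [← h2]
        exact mul_le_mul (by linarith) h1 h4 (by norm_num)
    _ ≤ 3 / 5 := by norm_num

/-- `Γ(5/2) = 3√π/4`. [folklore] -/
private theorem gamma_five_halves : Real.Gamma (5 / 2) = 3 * Real.sqrt π / 4 := by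
  have h := Real.Gamma_nat_add_half 2
  rw [show ((2 : ℕ) : ℝ) + 1 / 2 = 5 / 2 by norm_num] at h
  rw [h]
  norm_num [Nat.doubleFactorial]

/-- **The Laplace bound with the sharp leading constant**: for `s > 0`,
`B(s) ≤ √(2π/s) + A·s^{-3/2} + π e^{-s}`, `A = (√π/32)(1/2 − π²/96)^{-5/2}`. On `|k| ≤ π/2`:
`e^{−s(1−cos k)} ≤ e^{−sk²/2}e^{sk⁴/24} ≤ e^{−sk²/2}(1 + (sk⁴/24)e^{sπ²k²/96})`, and the two pieces
integrate to at most `√(2π/s)` and `(s/24)·(3√π/4)(s b₀)^{-5/2}`; on `π/2 ≤ |k| ≤ π` the integrand is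
at most `e^{-s}`. (an elementary bound on the cited factor, proved here) [cite: FILS1978, (4.7)] -/
theorem besselFactor_le_laplace {s : ℝ} (hs : 0 < s) :
    besselFactor s ≤
      Real.sqrt (2 * π / s) + Real.sqrt π / 32 * (1 / 2 - π ^ 2 / 96) ^ (-(5 / 2 : ℝ)) * s ^ (-(3 / 2 : ℝ)) +
        π * Real.exp (-s) := by
  have hπ := Real.pi_pos
  set δ : ℝ := π / 2 with hδ
  have hb := laplaceRate_pos
  set b₀ : ℝ := 1 / 2 - π ^ 2 / 96 with hb₀
  set c : ℝ := s * b₀ with hc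
  have hc0 : 0 < c := mul_pos hs hb
  set g : ℝ → ℝ := fun k => Real.exp (-(s * (1 - Real.cos k))) with hg
  have hgi : ∀ a b : ℝ, IntervalIntegrable g volume a b := fun a b =>
    (continuous_integrand s).intervalIntegrable a b
  -- the split `[-π,π] = [-π,-π/2] ∪ [-π/2,π/2] ∪ [π/2,π]`
  have hsplit : besselFactor s =
      (∫ k in (-π)..(-δ), g k) + (∫ k in (-δ)..δ, g k) + ∫ k in δ..π, g k := by
    unfold besselFactor
    rw [intervalIntegral.integral_add_adjacent_intervals (hgi _ _) (hgi _ _),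
      intervalIntegral.integral_add_adjacent_intervals (hgi _ _) (hgi _ _)]
  -- the tails
  have htail_pt : ∀ k : ℝ, δ ≤ |k| → |k| ≤ π → g k ≤ Real.exp (-s) := by
    intro k h1 h2
    have hcos : Real.cos k ≤ 0 := by
      rw [← Real.cos_abs]
      exact Real.cos_nonpos_of_pi_div_two_le_of_le h1 (by linarith)
    show Real.exp (-(s * (1 - Real.cos k))) ≤ Real.exp (-s)
    rw [Real.exp_le_exp]
    nlinarith
  have htail1 : ∫ k in δ..π, g k ≤ π / 2 * Real.exp (-s) := by
    have hle : δ ≤ π := by rw [hδ]; linarith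
    calc ∫ k in δ..π, g k ≤ ∫ _ in δ..π, Real.exp (-s) := by
          refine intervalIntegral.integral_mono_on hle (hgi _ _) (by simp) fun k hk => ?_
          have hk0 : 0 ≤ k := by linarith [hk.1]
          exact htail_pt k (by rw [abs_of_nonneg hk0]; exact hk.1)
            (by rw [abs_of_nonneg hk0]; exact hk.2)
      _ = π / 2 * Real.exp (-s) := by
          rw [intervalIntegral.integral_const, smul_eq_mul, hδ]; ring
  have htail2 : ∫ k in (-π)..(-δ), g k ≤ π / 2 * Real.exp (-s) := by
    have hle : -π ≤ -δ := by rw [hδ]; linarith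
    calc ∫ k in (-π)..(-δ), g k ≤ ∫ _ in (-π)..(-δ), Real.exp (-s) := by
          refine intervalIntegral.integral_mono_on hle (hgi _ _) (by simp) fun k hk => ?_
          have hk0 : k ≤ 0 := by linarith [hk.2]
          exact htail_pt k (by rw [abs_of_nonpos hk0]; linarith [hk.2])
            (by rw [abs_of_nonpos hk0]; linarith [hk.1])
      _ = π / 2 * Real.exp (-s) := by
          rw [intervalIntegral.integral_const, smul_eq_mul, hδ]; ring
  -- the middle: pointwise
  have hmid_pt : ∀ k ∈ Icc (-δ) δ,
      g k ≤ Real.exp (-(s / 2) * k ^ 2) + s / 24 * (k ^ 4 * Real.exp (-c * k ^ 2)) := by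
    intro k hk
    have hk2 : k ^ 2 ≤ π ^ 2 / 4 := by
      have habs : |k| ≤ π / 2 := abs_le.2 ⟨hk.1, hk.2⟩
      have h0 : 0 ≤ |k| := abs_nonneg k
      calc k ^ 2 = |k| ^ 2 := (sq_abs k).symm
        _ ≤ (π / 2) ^ 2 := pow_le_pow_left₀ h0 habs 2
        _ = π ^ 2 / 4 := by ring
    have hq := sq_half_sub_le_one_sub_cos k
    have h1 : g k ≤ Real.exp (-(s / 2) * k ^ 2 + s / 24 * k ^ 4) := by
      show Real.exp (-(s * (1 - Real.cos k))) ≤ _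
      rw [Real.exp_le_exp]
      have := mul_le_mul_of_nonneg_left hq hs.le
      nlinarith
    have h2 : Real.exp (-(s / 2) * k ^ 2 + s / 24 * k ^ 4) =
        Real.exp (-(s / 2) * k ^ 2) * Real.exp (s / 24 * k ^ 4) := Real.exp_add _ _
    have hy : Real.exp (s / 24 * k ^ 4) ≤ 1 + s / 24 * k ^ 4 * Real.exp (s / 24 * k ^ 4) :=
      exp_le_one_add_mul_exp _
    have h3 : Real.exp (s / 24 * k ^ 4) ≤ Real.exp (s * π ^ 2 / 96 * k ^ 2) := by
      rw [Real.exp_le_exp]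
      have h4 : k ^ 4 ≤ π ^ 2 / 4 * k ^ 2 := by nlinarith [sq_nonneg k]
      nlinarith [hs.le]
    have hE : 0 < Real.exp (-(s / 2) * k ^ 2) := Real.exp_pos _
    have h4 : Real.exp (-(s / 2) * k ^ 2) * Real.exp (s * π ^ 2 / 96 * k ^ 2) =
        Real.exp (-c * k ^ 2) := by
      rw [← Real.exp_add]
      congr 1
      rw [hc, hb₀]
      ring
    have hnn : 0 ≤ s / 24 * k ^ 4 := by positivity
    calc g k ≤ Real.exp (-(s / 2) * k ^ 2) * Real.exp (s / 24 * k ^ 4) := by rw [← h2]; exact h1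
      _ ≤ Real.exp (-(s / 2) * k ^ 2) * (1 + s / 24 * k ^ 4 * Real.exp (s * π ^ 2 / 96 * k ^ 2)) := by
          refine mul_le_mul_of_nonneg_left ?_ hE.le
          have := mul_le_mul_of_nonneg_left h3 hnn
          linarith
      _ = Real.exp (-(s / 2) * k ^ 2) + s / 24 * (k ^ 4 * Real.exp (-c * k ^ 2)) := by
          rw [← h4]; ring
  -- the middle: the two integrals
  have hδle : -δ ≤ δ := by rw [hδ]; linarith
  have hG1 : ∫ k in (-δ)..δ, Real.exp (-(s / 2) * k ^ 2) ≤ Real.sqrt (2 * π / s) := by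
    have hgi' := integrable_exp_neg_mul_sq (by positivity : 0 < s / 2)
    calc ∫ k in (-δ)..δ, Real.exp (-(s / 2) * k ^ 2) ≤ ∫ k, Real.exp (-(s / 2) * k ^ 2) := by
          rw [intervalIntegral.integral_of_le hδle]
          exact setIntegral_le_integral hgi' (Eventually.of_forall fun k => (Real.exp_pos _).le)
      _ = Real.sqrt (π / (s / 2)) := integral_gaussian (s / 2)
      _ = Real.sqrt (2 * π / s) := by
          congr 1
          field_simp
  have hG2 : ∫ k in (-δ)..δ, k ^ 4 * Real.exp (-c * k ^ 2) ≤
      c ^ (-(5 / 2 : ℝ)) * (3 * Real.sqrt π / 4) := by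
    have hint : Integrable (fun k : ℝ => k ^ 4 * Real.exp (-c * k ^ 2)) := by
      have h := integrable_rpow_mul_exp_neg_mul_sq hc0 (by norm_num : (-1 : ℝ) < 4)
      refine h.congr (ae_of_all _ fun x => ?_)
      show x ^ (4 : ℝ) * Real.exp (-c * x ^ 2) = x ^ 4 * Real.exp (-c * x ^ 2)
      rw [show (4 : ℝ) = ((4 : ℕ) : ℝ) by norm_num, Real.rpow_natCast]
    have hfun2 : ∀ x : ℝ, |x| ^ 4 * Real.exp (-c * |x| ^ 2) = x ^ 4 * Real.exp (-c * x ^ 2) := by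
      intro x
      rw [show |x| ^ 4 = (|x| ^ 2) ^ 2 by ring, sq_abs]
      ring
    have hwhole : ∫ k, k ^ 4 * Real.exp (-c * k ^ 2) =
        2 * ∫ k in Ioi (0 : ℝ), k ^ 4 * Real.exp (-c * k ^ 2) := by
      have h := integral_comp_abs (f := fun y : ℝ => y ^ 4 * Real.exp (-c * y ^ 2))
      simp only [hfun2] at h
      exact h
    have hfun : ∀ x ∈ Ioi (0 : ℝ),
        x ^ (4 : ℝ) * Real.exp (-c * x ^ (2 : ℝ)) = x ^ 4 * Real.exp (-c * x ^ 2) := by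
      intro x _
      rw [show (4 : ℝ) = ((4 : ℕ) : ℝ) by norm_num, Real.rpow_natCast, Real.rpow_two]
    have hIoi : ∫ k in Ioi (0 : ℝ), k ^ 4 * Real.exp (-c * k ^ 2) =
        c ^ (-(5 / 2 : ℝ)) * (1 / 2) * Real.Gamma (5 / 2) := by
      have h := integral_rpow_mul_exp_neg_mul_rpow (p := 2) (q := 4) (b := c)
        (by norm_num) (by norm_num) hc0
      rw [← setIntegral_congr_fun measurableSet_Ioi hfun, h]
      norm_num
    calc ∫ k in (-δ)..δ, k ^ 4 * Real.exp (-c * k ^ 2) ≤ ∫ k, k ^ 4 * Real.exp (-c * k ^ 2) := by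
          rw [intervalIntegral.integral_of_le hδle]
          exact setIntegral_le_integral hint (Eventually.of_forall fun k => by positivity)
      _ = c ^ (-(5 / 2 : ℝ)) * (3 * Real.sqrt π / 4) := by
          rw [hwhole, hIoi, gamma_five_halves]; ring
  have hmid : ∫ k in (-δ)..δ, g k ≤
      Real.sqrt (2 * π / s) + Real.sqrt π / 32 * b₀ ^ (-(5 / 2 : ℝ)) * s ^ (-(3 / 2 : ℝ)) := by
    have hI1 : IntervalIntegrable (fun k : ℝ => Real.exp (-(s / 2) * k ^ 2)) volume (-δ) δ :=
      (by fun_prop : Continuous fun k : ℝ => Real.exp (-(s / 2) * k ^ 2)).intervalIntegrable _ _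
    have hI2 : IntervalIntegrable (fun k : ℝ => s / 24 * (k ^ 4 * Real.exp (-c * k ^ 2)))
        volume (-δ) δ :=
      (by fun_prop : Continuous fun k : ℝ => s / 24 * (k ^ 4 * Real.exp (-c * k ^ 2))).intervalIntegrable _ _
    have hs24 : 0 ≤ s / 24 := by positivity
    have hpow : s * s ^ (-(5 / 2 : ℝ)) = s ^ (-(3 / 2 : ℝ)) := by
      rw [show (-(3 / 2 : ℝ)) = 1 + -(5 / 2 : ℝ) by norm_num, Real.rpow_add hs, Real.rpow_one]
    calc ∫ k in (-δ)..δ, g k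
        ≤ ∫ k in (-δ)..δ, (Real.exp (-(s / 2) * k ^ 2) + s / 24 * (k ^ 4 * Real.exp (-c * k ^ 2))) :=
          intervalIntegral.integral_mono_on hδle (hgi _ _) (hI1.add hI2) hmid_pt
      _ = (∫ k in (-δ)..δ, Real.exp (-(s / 2) * k ^ 2)) +
            s / 24 * ∫ k in (-δ)..δ, k ^ 4 * Real.exp (-c * k ^ 2) := by
          rw [intervalIntegral.integral_add hI1 hI2, intervalIntegral.integral_const_mul]
      _ ≤ Real.sqrt (2 * π / s) + s / 24 * (c ^ (-(5 / 2 : ℝ)) * (3 * Real.sqrt π / 4)) := by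
          have := mul_le_mul_of_nonneg_left hG2 hs24
          linarith [hG1]
      _ = Real.sqrt (2 * π / s) + Real.sqrt π / 32 * b₀ ^ (-(5 / 2 : ℝ)) * s ^ (-(3 / 2 : ℝ)) := by
          rw [hc, Real.mul_rpow hs.le hb.le, ← hpow]
          ring
  rw [hsplit]
  linarith [htail1, htail2, hmid]

/-- `t^{3/2} e^{-t} ≤ 9/20` for `t ≥ 0` (`√t ≤ 5t/12 + 3/5`, `te^{-t} ≤ e^{-1}`, `t²e^{-t} ≤ 4e^{-2}`;
the true maximum is `(3/(2e))^{3/2} ≈ 0.41`). [folklore] -/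
private theorem rpow_three_halves_mul_exp_neg_le {t : ℝ} (ht : 0 ≤ t) :
    t ^ (3 / 2 : ℝ) * Real.exp (-t) ≤ 9 / 20 := by
  have h1 : t * Real.exp (-t) ≤ Real.exp (-1) := by
    have h := Real.add_one_le_exp (t - 1)
    calc t * Real.exp (-t) ≤ Real.exp (t - 1) * Real.exp (-t) :=
          mul_le_mul_of_nonneg_right (by linarith) (Real.exp_pos _).le
      _ = Real.exp (-1) := by rw [← Real.exp_add]; ring_nf
  have h2 : t ^ 2 * Real.exp (-t) ≤ 4 * Real.exp (-2) := by
    have h := Real.add_one_le_exp (t / 2 - 1)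
    have hh : t / 2 ≤ Real.exp (t / 2 - 1) := by linarith
    have hsq : (t / 2) ^ 2 ≤ Real.exp (t / 2 - 1) ^ 2 := pow_le_pow_left₀ (by positivity) hh 2
    have heq : Real.exp (t / 2 - 1) ^ 2 * Real.exp (-t) = Real.exp (-2) := by
      rw [sq, ← Real.exp_add, ← Real.exp_add]; ring_nf
    calc t ^ 2 * Real.exp (-t) = 4 * ((t / 2) ^ 2 * Real.exp (-t)) := by ring
      _ ≤ 4 * (Real.exp (t / 2 - 1) ^ 2 * Real.exp (-t)) := by
          have := mul_le_mul_of_nonneg_right hsq (Real.exp_pos (-t)).le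
          linarith
      _ = 4 * Real.exp (-2) := by rw [heq]
  have he1 : Real.exp (-1) ≤ 0.3679 := by
    have h := Real.exp_one_gt_d9
    rw [Real.exp_neg, inv_le_comm₀ (Real.exp_pos 1) (by norm_num)]
    linarith
  have he2 : Real.exp (-2) ≤ 0.1354 := by
    have h : Real.exp (-2) = Real.exp (-1) ^ 2 := by rw [sq, ← Real.exp_add]; norm_num
    rw [h]
    nlinarith [he1, Real.exp_pos (-1)]
  have hsqrt : Real.sqrt t ≤ 5 * t / 12 + 3 / 5 := by
    nlinarith [Real.sq_sqrt ht, Real.sqrt_nonneg t, sq_nonneg (Real.sqrt t - 6 / 5)]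
  have ht32 : t ^ (3 / 2 : ℝ) = t * Real.sqrt t := by
    rw [show (3 / 2 : ℝ) = 1 + 1 / 2 by norm_num, Real.rpow_add' ht (by norm_num), Real.rpow_one,
      Real.sqrt_eq_rpow]
  rw [ht32]
  have hte : 0 ≤ t * Real.exp (-t) := by positivity
  calc t * Real.sqrt t * Real.exp (-t) = Real.sqrt t * (t * Real.exp (-t)) := by ring
    _ ≤ (5 * t / 12 + 3 / 5) * (t * Real.exp (-t)) := mul_le_mul_of_nonneg_right hsqrt hte
    _ = 5 / 12 * (t ^ 2 * Real.exp (-t)) + 3 / 5 * (t * Real.exp (-t)) := by ring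
    _ ≤ 5 / 12 * (4 * 0.1354) + 3 / 5 * 0.3679 := by linarith [h1, h2, he1, he2]
    _ ≤ 9 / 20 := by norm_num

/-- **Two-term form for `t ≥ 1`: `B(t) ≤ √(2π/t) + (21/10)·t^{-3/2}`** (`A ≤ 3/5` and
`πe^{-t} ≤ π(9/20)t^{-3/2}`). (an elementary bound on the cited factor, proved here) [cite: FILS1978, (4.7)] -/
theorem besselFactor_le_two_term {t : ℝ} (ht : 1 ≤ t) :
    besselFactor t ≤ Real.sqrt (2 * π / t) + 21 / 10 * t ^ (-(3 / 2 : ℝ)) := by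
  have ht0 : 0 < t := by linarith
  have h := besselFactor_le_laplace ht0
  have hA := laplaceConst_le
  have hB := rpow_three_halves_mul_exp_neg_le ht0.le
  have hpos : 0 < t ^ (-(3 / 2 : ℝ)) := Real.rpow_pos_of_pos ht0 _
  have hpow : t ^ (3 / 2 : ℝ) * t ^ (-(3 / 2 : ℝ)) = 1 := by
    rw [← Real.rpow_add ht0]; norm_num
  have hexp : π * Real.exp (-t) ≤ π * (9 / 20) * t ^ (-(3 / 2 : ℝ)) := by
    have heq : Real.exp (-t) = t ^ (-(3 / 2 : ℝ)) * (t ^ (3 / 2 : ℝ) * Real.exp (-t)) := by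
      calc Real.exp (-t) = t ^ (3 / 2 : ℝ) * t ^ (-(3 / 2 : ℝ)) * Real.exp (-t) := by
            rw [hpow, one_mul]
        _ = _ := by ring
    rw [heq]
    have := mul_le_mul_of_nonneg_left hB (mul_nonneg Real.pi_pos.le hpos.le)
    calc π * (t ^ (-(3 / 2 : ℝ)) * (t ^ (3 / 2 : ℝ) * Real.exp (-t)))
        = π * t ^ (-(3 / 2 : ℝ)) * (t ^ (3 / 2 : ℝ) * Real.exp (-t)) := by ring
      _ ≤ π * t ^ (-(3 / 2 : ℝ)) * (9 / 20) := this
      _ = π * (9 / 20) * t ^ (-(3 / 2 : ℝ)) := by ring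
  have hA' : Real.sqrt π / 32 * (1 / 2 - π ^ 2 / 96) ^ (-(5 / 2 : ℝ)) * t ^ (-(3 / 2 : ℝ)) ≤
      3 / 5 * t ^ (-(3 / 2 : ℝ)) :=
    mul_le_mul_of_nonneg_right hA hpos.le
  have hπ := Real.pi_lt_d2
  nlinarith [h, hexp, hA', hpos]

/-- `√(2π/t) = √(2π)·t^{-1/2}` for `t > 0`. [folklore] -/
private theorem sqrt_two_pi_div {t : ℝ} (ht : 0 < t) :
    Real.sqrt (2 * π / t) = Real.sqrt (2 * π) * t ^ (-(1 / 2 : ℝ)) := by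
  rw [Real.sqrt_div' _ ht.le, Real.sqrt_eq_rpow t, Real.rpow_neg ht.le, div_eq_mul_inv]

/-- `(t^{-1/2})ⁿ = t^{-n/2}` for `t > 0`. [folklore] -/
private theorem rpow_neg_half_pow {t : ℝ} (ht : 0 < t) (n : ℕ) :
    (t ^ (-(1 / 2 : ℝ))) ^ n = t ^ (-(n : ℝ) / 2) := by
  rw [← Real.rpow_natCast, ← Real.rpow_mul ht.le]
  congr 1
  ring

/-- **`B(t)² ≤ 2π t^{-1} + (21/5)√(2π) t^{-2} + (441/100) t^{-3}` for `t ≥ 1`** (the square of the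
two-term form). (an elementary bound on the cited factor, proved here) [cite: FILS1978, (4.7)] -/
theorem besselFactor_sq_le {t : ℝ} (ht : 1 ≤ t) :
    besselFactor t * besselFactor t ≤
      2 * π * t ^ (-(1 : ℝ)) + 21 / 5 * Real.sqrt (2 * π) * t ^ (-(2 : ℝ)) +
        441 / 100 * t ^ (-(3 : ℝ)) := by
  have ht0 : 0 < t := by linarith
  set x : ℝ := t ^ (-(1 / 2 : ℝ)) with hx
  have hx0 : 0 ≤ x := Real.rpow_nonneg ht0.le _
  have hB : besselFactor t ≤ Real.sqrt (2 * π) * x + 21 / 10 * x ^ 3 := by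
    have h := besselFactor_le_two_term ht
    rw [sqrt_two_pi_div ht0] at h
    have h3 : t ^ (-(3 / 2 : ℝ)) = x ^ 3 := by
      rw [hx, rpow_neg_half_pow ht0 3]; norm_num
    rwa [h3] at h
  have h0 := zero_le_besselFactor t
  have h2π : 0 ≤ 2 * π := by positivity
  have hsq : Real.sqrt (2 * π) * Real.sqrt (2 * π) = 2 * π := Real.mul_self_sqrt h2π
  have hx2 : t ^ (-(1 : ℝ)) = x ^ 2 := by rw [hx, rpow_neg_half_pow ht0 2]; norm_num
  have hx4 : t ^ (-(2 : ℝ)) = x ^ 4 := by rw [hx, rpow_neg_half_pow ht0 4]; norm_num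
  have hx6 : t ^ (-(3 : ℝ)) = x ^ 6 := by rw [hx, rpow_neg_half_pow ht0 6]; norm_num
  rw [hx2, hx4, hx6]
  have hM : 0 ≤ Real.sqrt (2 * π) * x + 21 / 10 * x ^ 3 := by positivity
  calc besselFactor t * besselFactor t
      ≤ (Real.sqrt (2 * π) * x + 21 / 10 * x ^ 3) * (Real.sqrt (2 * π) * x + 21 / 10 * x ^ 3) :=
        mul_le_mul hB hB h0 hM
    _ = 2 * π * x ^ 2 + 21 / 5 * Real.sqrt (2 * π) * x ^ 4 + 441 / 100 * x ^ 6 := by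
        have : (Real.sqrt (2 * π) * x + 21 / 10 * x ^ 3) * (Real.sqrt (2 * π) * x + 21 / 10 * x ^ 3)
            = Real.sqrt (2 * π) * Real.sqrt (2 * π) * x ^ 2 + 21 / 5 * Real.sqrt (2 * π) * x ^ 4 +
              441 / 100 * x ^ 6 := by ring
        rw [this, hsq]

/-! ### The Gaussian lower bound -/

/-- **`B(s) ≥ √(2π/s) − (4/(πs))e^{−π²s/2}`** for `s > 0` (`1 − cos k ≤ k²/2`, so `B(s)` dominates the
Gaussian integral over `[-π,π]`, whose two tails are at most `∫_π^∞ e^{−sπk/2}dk` each). (an elementary bound on the cited factor, proved here) [cite: FILS1978, (4.7)] -/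
theorem besselFactor_ge_gaussian {s : ℝ} (hs : 0 < s) :
    Real.sqrt (2 * π / s) - 4 / (π * s) * Real.exp (-(π ^ 2 * s / 2)) ≤ besselFactor s := by
  have hπ := Real.pi_pos
  have hle : (-π : ℝ) ≤ π := by linarith
  set G : ℝ → ℝ := fun k => Real.exp (-(s / 2) * k ^ 2) with hG
  have hGi : Integrable G := integrable_exp_neg_mul_sq (by positivity : 0 < s / 2)
  have hGc : Continuous G := by fun_prop
  -- `B(s) ≥ ∫_{-π}^{π} G`
  have hdom : ∫ k in (-π)..π, G k ≤ besselFactor s := by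
    unfold besselFactor
    refine intervalIntegral.integral_mono_on hle (hGc.intervalIntegrable _ _)
      ((continuous_integrand s).intervalIntegrable _ _) fun k _ => ?_
    show Real.exp (-(s / 2) * k ^ 2) ≤ Real.exp (-(s * (1 - Real.cos k)))
    rw [Real.exp_le_exp]
    have := Real.one_sub_sq_div_two_le_cos (x := k)
    nlinarith
  -- `∫_{-π}^{π} G = ∫_ℝ G − 2∫_{(π,∞)} G`
  have hI1 : IntegrableOn G (Iic (-π)) := hGi.integrableOn
  have hI2 : IntegrableOn G (Ioc (-π) π) := hGi.integrableOn
  have hI3 : IntegrableOn G (Ioi π) := hGi.integrableOn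
  have hsplit : ∫ k, G k = (∫ k in Iic (-π), G k) + (∫ k in Ioc (-π) π, G k) + ∫ k in Ioi π, G k := by
    rw [← setIntegral_union (Set.Iic_disjoint_Ioc (le_refl _)) measurableSet_Ioc hI1 hI2,
      Set.Iic_union_Ioc_eq_Iic hle,
      ← setIntegral_union (Set.Iic_disjoint_Ioi (le_refl _)) measurableSet_Ioi
        (hGi.integrableOn) hI3,
      Set.Iic_union_Ioi, setIntegral_univ]
  have hsymm : ∫ k in Iic (-π), G k = ∫ k in Ioi π, G k := by
    rw [← integral_comp_neg_Ioi]
    refine setIntegral_congr_fun measurableSet_Ioi fun k _ => ?_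
    simp only [hG, neg_sq]
  -- the tail
  have htail : ∫ k in Ioi π, G k ≤ 2 / (π * s) * Real.exp (-(π ^ 2 * s / 2)) := by
    have ha : -(s * π / 2) < 0 := by nlinarith
    have hIe := integrableOn_exp_mul_Ioi ha π
    calc ∫ k in Ioi π, G k ≤ ∫ k in Ioi π, Real.exp (-(s * π / 2) * k) := by
          refine setIntegral_mono_on hI3 hIe measurableSet_Ioi fun k hk => ?_
          show Real.exp (-(s / 2) * k ^ 2) ≤ Real.exp (-(s * π / 2) * k)
          rw [Real.exp_le_exp]
          have hk : π < k := hk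
          nlinarith [mul_pos hs (sub_pos.2 hk), hk]
      _ = -Real.exp (-(s * π / 2) * π) / (-(s * π / 2)) := integral_exp_mul_Ioi ha π
      _ = 2 / (π * s) * Real.exp (-(π ^ 2 * s / 2)) := by
          rw [show -(s * π / 2) * π = -(π ^ 2 * s / 2) by ring]
          field_simp
  have hval : ∫ k, G k = Real.sqrt (2 * π / s) := by
    rw [hG, integral_gaussian (s / 2)]
    congr 1
    field_simp
  have htail2 : 2 * ∫ k in Ioi π, G k ≤ 4 / (π * s) * Real.exp (-(π ^ 2 * s / 2)) := by
    calc 2 * ∫ k in Ioi π, G k ≤ 2 * (2 / (π * s) * Real.exp (-(π ^ 2 * s / 2))) := by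
          linarith [htail]
      _ = 4 / (π * s) * Real.exp (-(π ^ 2 * s / 2)) := by ring
  calc Real.sqrt (2 * π / s) - 4 / (π * s) * Real.exp (-(π ^ 2 * s / 2))
      ≤ (∫ k, G k) - 2 * ∫ k in Ioi π, G k := by rw [hval]; linarith [htail2]
    _ = ∫ k in Ioc (-π) π, G k := by rw [hsplit, hsymm]; ring
    _ = ∫ k in (-π)..π, G k := (intervalIntegral.integral_of_le hle).symm
    _ ≤ besselFactor s := hdom

end AnisotropicRotator

end Literature.Probability.LatticeModels
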